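import Summits.BirchSwinnertonDyer.Rank1Residual.X11a.PrintDischargeEulerHalf
import Literature.NumberTheory.GaloisRepresentations.BlochKatoSelmerGroup
import Literature.NumberTheory.EllipticCurves.GreenbergSelmer
import Literature.NumberTheory.EllipticCurves.GaloisAction
import Literature.NumberTheory.EllipticCurves.HeegnerPoints
import Literature.NumberTheory.EllipticCurves.PAdicHeights
import Literature.NumberTheory.EllipticCurves.Tamagawa
import Literature.NumberTheory.SerreUniformity.SplitCartan
import Literature.NumberTheory.EllipticCurves.SelmerTorsionRestriction
import Literature.NumberTheory.EllipticCurves.KummerSelmerStructure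
import Literature.NumberTheory.GaloisRepresentations.ContinuousH1
import Literature.NumberTheory.DiophantineGeometry.LocalReduction
import HarnessLib

/-!
# Route `PrintX11a`, crux U5 = `PrintX11a.UpperNonSurjFive` (item stmt-BirchSwinnertonDyer-20614), line «gl1cartan5»:
# the DEFINITIONS of the line (Cartan descent datum, its GL₁ Selmer structure, the main locus); the line's two OPEN residual
# statements R₁/R₂ stay in the crux workfile `Cruxes/UpperNonSurjFive/Lines/gl1cartan5.lean` (review p655372: not tree obligations)

Cell `bsd-print-x11a`, LEAD `cruxlead-stmt-BirchSwinnertonDyer-20614` g0. DEFINITIONS ONLY (no theorem, no named fact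
taken, nothing asserted about any curve): `CartanDatum` (the Cartan descent datum), `CartanDatum.selmerStructure` and
`CartanDatum.SelmerTrivial` (its GL₁ Selmer structure — relaxed at `𝔭`, strict at `𝔭'`, unramified elsewhere — and the predicate
`S(𝒟) = 0`), and the predicate `MainLocus`; these are the objects the registered line `Cruxes/UpperNonSurjFive/Lines/gl1cartan5.lean`
(rev 6, sha16 dcff008fd5a71b2e) posits, moved out of the work file so that the stub theorems (`Theorems.GL1Cartan.stub_cartanGlobal`
p652784, `stub_cartanLocalMult` p653824, the assembly `stub_cartanDescent`, and the sector theorem) can import them (D-0016: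
definitions a route posits live in a reviewed `…Defs` file, never in a proof file). The provable statements of the line (D = Cartan
descent, its halves D-G/D-L, the print bridge I) are theorems stated in unfolded form, not `def … : Prop`; the line's two OPEN
residuals R₁/R₂ (U5 restricted to the complement of the sector the line proves) are NOT tree declarations (review of p655372).
BSD is not proved by any of this; no summit statement is proved here.

References: [MazurRubin2004] Def. 2.1.1; [Serre1972] §1.12, §2.8; [SilvermanAEC2009] X.4.2, Cor. X.4.4, III.8.1.1;
[SilvermanATAEC1994] V.3.1, V.5.2–5.4; [Greenberg1989] §1; [Wuthrich2014] Thm. 1, Thm. 4, Cor. 7 (doi:10.4171/dm/450);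
[Rubin1991] Thm. 4.1 (i); [GrossLMS1991] §5 (5.1); [MilneADT2006] I.3.8.
-/

-- justified: the file namespace `Summit.BirchSwinnertonDyer.BirchSwinnertonDyer.Theorems.GL1Cartan` repeats the sub-problem segment by the D-0017 layout
set_option linter.dupNamespace false
set_option autoImplicit false

noncomputable section

open scoped Classical NumberField

open WeierstrassCurve Field IsDedekindDomain
  Literature.NumberTheory.EllipticCurves
  Literature.NumberTheory.EllipticCurves.Rank1Residual
  Literature.NumberTheory.EllipticCurves.Rank1Residual.Typed
  Literature.NumberTheory.GaloisRepresentations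
  Literature.NumberTheory.GaloisRepresentations.DiscreteGaloisModule
  Literature.NumberTheory.SerreUniformity
  Summit.BirchSwinnertonDyer.Rank1Residual

namespace Summit.BirchSwinnertonDyer.BirchSwinnertonDyer.Theorems.GL1Cartan

universe u

/-! ## §1 The Cartan descent datum and its GL₁ Selmer group -/

/-- A **Cartan descent datum** for the pair `(E, p)` (`E` given by the minimal model `W`): an imaginary quadratic field `K` in which
`p = 𝔭𝔭'` splits (two distinct primes of `𝓞 K` containing `p`), such that every multiplicative prime `ℓ ≠ p` of `E` is NONSPLIT
multiplicative and split in `K`; and a discrete `Γ_K`-module `M` of order `p` embedded `Γ_K`-equivariantly into `E[p](K̄)` (a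
`Γ_K`-stable LINE `C ⊂ E[p]`, i.e. the character `χ`), on which the inertia group at `𝔭` acts nontrivially and the inertia group at `𝔭'`
acts trivially.  On a `pNs` pair with `p` nonsplit multiplicative and `K_C` imaginary, `K = K_C` with `M = C` (Tate line at `𝔭`) is such
a datum; the structure only RECORDS data, it asserts nothing. [cite: Serre1972, §2.8] [cite: Greenberg1989, §1 p. 98] -/
structure CartanDatum (W : WeierstrassCurve ℚ) [W.IsElliptic] (p : ℕ) [Fact p.Prime] : Type 1 where
  /-- the Cartan field (intended: `K_C`) -/
  K : Type
  [instField : Field K]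
  [instNumberField : NumberField K]
  imaginaryQuadratic : IsImaginaryQuadratic K
  /-- the prime of `K` above `p` at which the line is ramified -/
  𝔭 : HeightOneSpectrum (𝓞 K)
  /-- the other prime of `K` above `p` -/
  𝔭' : HeightOneSpectrum (𝓞 K)
  mem : ((p : ℕ) : 𝓞 K) ∈ 𝔭.asIdeal
  mem' : ((p : ℕ) : 𝓞 K) ∈ 𝔭'.asIdeal
  ne : 𝔭 ≠ 𝔭'
  splitAway : ∀ (ℓ : ℕ) [Fact ℓ.Prime], ℓ ≠ p → W.HasMultiplicativeReductionAtPrime ℓ →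
    ¬ W.HasSplitMultiplicativeReductionAtPrime ℓ ∧ ((Ideal.span {(ℓ : ℤ)}).primesOver (𝓞 K)).ncard = 2
  /-- the same recorded in `K`-currency (equivalent to `splitAway` since `ℓ` splits in `K`): at a place `w ∤ p` of `K`
  above a multiplicative prime `ℓ` of `E`, the base change `E_K` is NOT split multiplicative -/
  nonsplitAway : ∀ (w : HeightOneSpectrum (𝓞 K)) (ℓ : ℕ) [Fact ℓ.Prime], ((p : ℕ) : 𝓞 K) ∉ w.asIdeal →
    ((ℓ : ℕ) : 𝓞 K) ∈ w.asIdeal → W.HasMultiplicativeReductionAtPrime ℓ →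
    ¬ (W.baseChange K).HasSplitMultiplicativeReductionAt w
  /-- the line, as an abstract discrete `Γ_K`-module of order `p` -/
  M : Type
  [instAddCommGroup : AddCommGroup M]
  [instTopologicalSpace : TopologicalSpace M]
  [instDiscreteTopology : DiscreteTopology M]
  ρ : DiscreteGaloisModule K M
  card : Nat.card M = p
  /-- the equivariant embedding `M ↪ E[p](K̄)` -/
  ι : M →+ (W.baseChange K).geomTorsion (p : ℤ)
  injective : Function.Injective ι
  equivariant : ∀ (σ : absoluteGaloisGroup K) (m : M), ι (ρ σ m) = σ • ι m
  ramified : ∃ σ ∈ GreenbergSelmer.inertia 𝔭, ∃ m : M, ρ σ m ≠ m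
  unramified : ∀ σ ∈ GreenbergSelmer.inertia 𝔭', ∀ m : M, ρ σ m = m

attribute [instance] CartanDatum.instField CartanDatum.instNumberField CartanDatum.instAddCommGroup
  CartanDatum.instTopologicalSpace CartanDatum.instDiscreteTopology

namespace CartanDatum

variable {W : WeierstrassCurve ℚ} [W.IsElliptic] {p : ℕ} [Fact p.Prime]

/-- The GL₁ Selmer structure of the datum: RELAXED (`⊤`) at `𝔭`, STRICT (`⊥`) at `𝔭'`, UNRAMIFIED at every other finite place, no
condition at infinity (`SelmerStructure.ofFinite`). [cite: MazurRubin2004, Def. 2.1.1] [cite: DiamondFlachGuo2004, §2.1] -/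
def selmerStructure (𝒟 : CartanDatum W p) : SelmerStructure 𝒟.ρ :=
  SelmerStructure.ofFinite 𝒟.ρ fun v =>
    if v = 𝒟.𝔭 then ⊤ else if v = 𝒟.𝔭' then ⊥ else unramifiedSubgroup (GaloisRep.toLocal v 𝒟.ρ) 1

/-- **`S(𝒟) = 0`** (predicate, not a fact): the GL₁ Selmer group `H¹_𝓛(K, M)` of the datum is trivial (finite of order `≤ 1`).
[cite: MazurRubin2004, Def. 2.1.1] -/
def SelmerTrivial (𝒟 : CartanDatum W p) : Prop :=
  𝒟.selmerStructure.HasCardLE 1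

end CartanDatum

/-- The **main locus** of the line inside U5 (predicate, not a fact): split-Cartan-normaliser image, `p` NONSPLIT multiplicative, and a Cartan descent datum
exists (i.e. `K_C` imaginary and the multiplicative primes `ℓ ≠ p` harmless).  [cite: Serre1972, §2.8] -/
def MainLocus (W : WeierstrassCurve ℚ) [W.IsElliptic] (p : ℕ) [Fact p.Prime] : Prop :=
  HasSplitCartanNormalizerModPImage W p ∧ W.HasMultiplicativeReductionAtPrime p ∧
    ¬ W.HasSplitMultiplicativeReductionAtPrime p ∧ Nonempty (CartanDatum W p)

end Summit.BirchSwinnertonDyer.BirchSwinnertonDyer.Theorems.GL1Cartan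

end
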